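import Summits.KontsevichZagierPeriods.KontsevichZagierPeriods.Theses.FurushoPentagon
import Summits.KontsevichZagierPeriods.KontsevichZagierPeriods.Theorems.ReducedPeriodRing.Negative.PositiveCone
import Summits.KontsevichZagierPeriods.KontsevichZagierPeriods.Theorems.ReducedPeriodRing.Negative.ModelsAnatomy
import Literature.NumberTheory.Transcendental.KZLogCalculusProofs
import Literature.NumberTheory.Transcendental.KZVolumeConjectureProofs

/-!
# `ReducedPeriodRing` (stmt-KontsevichZagierPeriods-3929) — the shape of a witness: a NON-NEGATIVE pair

Sharpest normal form of a counterexample to the crux (`Negative/ModelsAnatomy.lean` gave one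
signed representation `u` with `[u ⊠ u] ∈ relations`, `[u] ∉ relations`; `Negative/PositiveCone.lean`
showed such a `u` changes sign). Splitting `u` along the sign of its integrand:

`¬ ReducedPeriodRing` iff there are two NON-NEGATIVE representations `a = [σ₊, f]`, `b = [σ₋, g]`
(`f, g ≥ 0`, same dimension) such that the calculus PROVES the AM–GM identity
`a ⊠ a + b ⊠ b ∼ a ⊠ b + b ⊠ a` (four non-negative product representations; both sides have value
`A² + B² = 2AB`, forcing `A = B`) but does NOT prove `a ∼ b` (`not_reducedPeriodRing_iff_nonneg_pair`).
Equivalently the crux is the rigidity statement `nonneg_pair_rigidity_iff`: for non-negative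
representations, a move chain for `a² + b² = 2ab` always upgrades to one for `a = b`.
Consequence: a witness is a pair of non-negative representations OF EQUAL VALUE which the calculus
cannot identify directly but CAN identify "one Fubini level up" in the symmetric combination — the
two-representation conjecture for non-negative integrands is implicated only through this
square. VOLUME FORM (`not_reducedPeriodRing_iff_volume_pair`, through the tree's PROVED Viu-Sos
semi-canonical reduction `KZ.semiCanonicalReduction_holds`): a nilpotent of the formal period ring
is the same thing as two COMPACT `ℚ`-semialgebraic bodies `A ⊂ ℝ^m`, `B ⊂ ℝ^{m'}` with non-empty
interiors (and, perforce, equal volume) such that the rules prove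
`vol(A × A) + vol(B × B) = vol(A × B) + vol(B × A)` but do not prove `vol A = vol B` — the crux in
the volume language of Cresson–Viu-Sos (JTNB 2022, §1). Also: a single witness may be taken of
KZ's literal rational shape (`not_reducedPeriodRing_iff_single_rational`).
cdisprove (refuter) file, cycle 2. [Kontsevich–Zagier 2001, §1.2, §4.1; Viu-Sos, IJNT 17 (2021),
Thm. 1.1; Cresson–Viu-Sos, JTNB 34 (2022), §1]
-/

noncomputable section

namespace Summit.KontsevichZagierPeriods.KontsevichZagierPeriods.ReducedPeriodRingNegative

open MeasureTheory Set
open Literature.NumberTheory.Transcendental KZ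
open Literature.ModelTheory.ExponentialFields (IsSemialgebraic)
open Summit.KontsevichZagierPeriods.KontsevichZagierPeriods.Theses.FurushoPentagon

variable {n : ℕ}

/-- The AM–GM combination is the square of the difference: `(a − b)² = a² + b² − (ab + ba)` in the
(non-commutative, non-associative) ring `FormalRep`. [folklore] -/
theorem sub_mul_sub_eq_amgm (a b : FormalRep) :
    (a - b) * (a - b) = a * a + b * b - (a * b + b * a) := by
  simp only [sub_mul, mul_sub]; abel

/-- **Explicit sign split**: every representation `r = [σ, f]` is equivalent to `[σ₊, f] − [σ₋, −f]`
with `σ₊ = {f ≥ 0}`, `σ₋ = {f < 0}` — two NON-NEGATIVE representations of the same dimension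
(domain additivity + `[τ, h] + [τ, −h] ∈ relations`). [Kontsevich–Zagier 2001, §1.2 rule (1)] -/
theorem exists_nonneg_pair_of (r : IntegralRep n) :
    ∃ a b : IntegralRep n, (∀ x ∈ a.domain, 0 ≤ a.integrand x) ∧
      (∀ x ∈ b.domain, 0 ≤ b.integrand x) ∧ of r - (of a - of b) ∈ relations := by
  set Sp : Set (Fin n → ℝ) := {x | x ∈ r.domain ∧ 0 ≤ r.integrand x} with hSp
  set Sm : Set (Fin n → ℝ) := {x | x ∈ r.domain ∧ r.integrand x < 0} with hSm
  have hSps : IsSemialgebraic ℚ Sp := isSemialgebraic_sep_integrand_nonneg r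
  have hSms : IsSemialgebraic ℚ Sm := isSemialgebraic_sep_integrand_neg r
  set rp : IntegralRep n := r.restrict Sp hSps (fun x hx => hx.1) with hrp
  set rm : IntegralRep n := r.restrict Sm hSms (fun x hx => hx.1) with hrm
  have hdisj : Sp ∩ Sm = ∅ := by
    rw [Set.eq_empty_iff_forall_notMem]
    rintro x ⟨hxp, hxm⟩
    exact absurd hxm.2 (not_lt.mpr hxp.2)
  have hsplit : of r - of rp - of rm ∈ domainAddRel := by
    refine ⟨n, r, rp, rm, ?_, ?_, fun _ _ => rfl, fun _ _ => rfl, rfl⟩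
    · ext x
      simp only [hrp, hrm, IntegralRep.domain_restrict, mem_union, hSp, hSm, mem_setOf_eq]
      constructor
      · intro hx
        rcases le_or_gt 0 (r.integrand x) with h | h
        · exact Or.inl ⟨hx, h⟩
        · exact Or.inr ⟨hx, h⟩
      · rintro (⟨hx, -⟩ | ⟨hx, -⟩) <;> exact hx
    · simp [hrp, hrm, hdisj]
  refine ⟨rp, rm.neg, fun x hx => hx.2, fun x hx => ?_, ?_⟩
  · have hx' : r.integrand x < 0 := hx.2
    simp only [IntegralRep.integrand_neg, Pi.neg_apply, hrm, IntegralRep.integrand_restrict]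
    linarith
  · have h1 := domainAddRel_subset_relations hsplit
    have h2 := of_add_of_neg_mem_relations rm
    have heq : of r - (of rp - of rm.neg) = (of r - of rp - of rm) + (of rm + of rm.neg) := by abel
    rw [heq]
    exact relations.add_mem h1 h2

/-- **Normal form of a witness: a non-negative pair.** `¬ ReducedPeriodRing` iff two NON-NEGATIVE
representations `a, b` of the same dimension have `a ⊠ a + b ⊠ b ∼ a ⊠ b + b ⊠ a` provable by the
moves while `a ∼ b` is not. (→: split the single signed witness of
`not_reducedPeriodRing_iff_single` along the sign of its integrand; ←: `(a − b)² = a² + b² − (ab + ba)`.)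
[folklore] -/
theorem not_reducedPeriodRing_iff_nonneg_pair :
    ¬ ReducedPeriodRing ↔ ∃ (N : ℕ) (a b : IntegralRep N),
      (∀ x ∈ a.domain, 0 ≤ a.integrand x) ∧ (∀ x ∈ b.domain, 0 ≤ b.integrand x) ∧
      of a * of a + of b * of b - (of a * of b + of b * of a) ∈ relations ∧ ¬ Equivalent a b := by
  constructor
  · intro h
    obtain ⟨N, u, hsq, hne⟩ := not_reducedPeriodRing_iff_single.mp h
    obtain ⟨a, b, ha, hb, hu⟩ := exists_nonneg_pair_of u
    refine ⟨N, a, b, ha, hb, ?_, fun he => hne ?_⟩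
    · have hd : (of a - of b) - of u ∈ relations := by simpa using relations.neg_mem hu
      have h1 := mul_sub_mul_mem_relations hd hd
      rw [of_mul_of] at h1
      have h2 : (of a - of b) * (of a - of b) ∈ relations := by
        have := relations.add_mem h1 hsq
        simpa using this
      rwa [sub_mul_sub_eq_amgm] at h2
    · have : of u = (of u - (of a - of b)) + (of a - of b) := by abel
      rw [this]
      exact relations.add_mem hu he
  · rintro ⟨N, a, b, -, -, hsq, hne⟩ h
    exact hne (h _ (by rw [sub_mul_sub_eq_amgm]; exact hsq))

/-- **The crux as AM–GM rigidity for non-negative PAIRS** (sharpens `reducedPeriodRing_iff_amgm_cone`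
of `Negative/PositiveCone.lean` from sums of non-negative representations to single ones):
`ReducedPeriodRing` iff for all non-negative representations `a, b` of a common dimension, a move
chain `a ⊠ a + b ⊠ b ∼ a ⊠ b + b ⊠ a` yields a move chain `a ∼ b`. [folklore] -/
theorem nonneg_pair_rigidity_iff :
    ReducedPeriodRing ↔ ∀ (N : ℕ) (a b : IntegralRep N),
      (∀ x ∈ a.domain, 0 ≤ a.integrand x) → (∀ x ∈ b.domain, 0 ≤ b.integrand x) →
      of a * of a + of b * of b - (of a * of b + of b * of a) ∈ relations → Equivalent a b := by
  constructor
  · intro h N a b _ _ hsq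
    exact h _ (by rw [sub_mul_sub_eq_amgm]; exact hsq)
  · intro h
    by_contra hc
    obtain ⟨N, a, b, ha, hb, hsq, hne⟩ := not_reducedPeriodRing_iff_nonneg_pair.mp hc
    exact hne (h N a b ha hb hsq)

/-- In a witness pair the two representations have the SAME VALUE (`(A − B)² = 0` in `ℝ`), so the
pair is in particular an instance of the two-representation conjecture for non-negative
integrands; but the converse fails to bite: equal values alone give no move chain for the square.
[folklore] -/
theorem value_eq_of_amgm_mem_relations {N : ℕ} (a b : IntegralRep N)
    (hsq : of a * of a + of b * of b - (of a * of b + of b * of a) ∈ relations) :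
    a.value = b.value := by
  have h0 : eval ((of a - of b) * (of a - of b)) = 0 := by
    rw [sub_mul_sub_eq_amgm]; exact relations_le_ker_eval_holds hsq
  rw [eval_mul', mul_self_eq_zero, map_sub, eval_of, eval_of, sub_eq_zero] at h0
  exact h0


/-! ### Rational and volume normal forms -/

/-- **A single witness of KZ's literal shape**: `¬ ReducedPeriodRing` iff some representation `u`
with RATIONAL integrand (`KZ.IntegralRep.IsRational`) has `[u ⊠ u] ∈ relations`, `[u] ∉ relations`
(`KZ.exists_isRational_equivalent`: algebraic integrands reduce to rational ones by the moves).
[Kontsevich–Zagier 2001, §1.1] -/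
theorem not_reducedPeriodRing_iff_single_rational :
    ¬ ReducedPeriodRing ↔
      ∃ (N : ℕ) (u : IntegralRep N), u.IsRational ∧ of (u.prod u) ∈ relations ∧ of u ∉ relations := by
  constructor
  · intro h
    obtain ⟨N, u, hsq, hne⟩ := not_reducedPeriodRing_iff_single.mp h
    obtain ⟨M, R, hR, huR⟩ := exists_isRational_equivalent_holds u
    refine ⟨M, R, hR, ?_, fun hR0 => hne ?_⟩
    · have hd : of R - of u ∈ relations := by simpa using relations.neg_mem huR
      have h1 := mul_sub_mul_mem_relations hd hd
      rw [of_mul_of, of_mul_of] at h1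
      have := relations.add_mem h1 hsq
      simpa using this
    · have := relations.add_mem huR hR0
      simpa using this
  · rintro ⟨N, u, -, hsq, hne⟩ h
    exact hne (h _ (by rw [of_mul_of]; exact hsq))

/-- A representation of POSITIVE value is equivalent to the volume of a compact `ℚ`-semialgebraic
body with non-empty interior (Viu-Sos' semi-canonical reduction, tree theorem
`KZ.semiCanonicalReduction_holds`, after `KZ.exists_isRational_equivalent`). [Viu-Sos, IJNT 17
(2021), Thm. 1.1] -/
theorem exists_compactVolume_of_value_pos (r : IntegralRep n) (h : 0 < r.value) :
    ∃ (m : ℕ) (K : IntegralRep m), IsCompact K.domain ∧ (interior K.domain).Nonempty ∧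
      (∀ z ∈ K.domain, K.integrand z = 1) ∧ of r - of K ∈ relations := by
  obtain ⟨M, R, hR, hrR⟩ := exists_isRational_equivalent_holds r
  have hRv : R.value = r.value := (Equivalent.value_eq_holds hrR).symm
  obtain ⟨m, K, -, -, hKc, hKi, hK1, hKpos, -⟩ :=
    semiCanonicalReduction_holds R hR (by rw [hRv]; exact h.ne')
  refine ⟨m, K, hKc, hKi, hK1, ?_⟩
  have h1 : of R - of K ∈ relations := hKpos (by rw [hRv]; exact h)
  have := relations.add_mem hrR h1
  simpa using this

/-- **Volume form of the crux.** `¬ ReducedPeriodRing` iff there are two COMPACT `ℚ`-semialgebraic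
bodies `A ⊂ ℝ^m`, `B ⊂ ℝ^{m'}` with non-empty interiors (volume representations `[A, 1]`, `[B, 1]`;
equal volumes by `value_eq_of_amgm_mem_relations`) such that the rules PROVE
`vol(A × A) + vol(B × B) = vol(A × B) + vol(B × A)` — a move chain between volumes of compact bodies
in `ℝ^{2m}`, `ℝ^{2m'}`, `ℝ^{m+m'}` — but do NOT prove `vol A = vol B`. (→: the non-negative pair of
`not_reducedPeriodRing_iff_nonneg_pair` has a positive common value, for value `0` would put both
members in `relations`; reduce each member to a compact volume and transport the chain.)
[Viu-Sos, IJNT 17 (2021), Thm. 1.1; Cresson–Viu-Sos, JTNB 34 (2022), §1] -/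
theorem not_reducedPeriodRing_iff_volume_pair :
    ¬ ReducedPeriodRing ↔ ∃ (m m' : ℕ) (A : IntegralRep m) (B : IntegralRep m'),
      IsCompact A.domain ∧ (interior A.domain).Nonempty ∧ (∀ z ∈ A.domain, A.integrand z = 1) ∧
      IsCompact B.domain ∧ (interior B.domain).Nonempty ∧ (∀ z ∈ B.domain, B.integrand z = 1) ∧
      of A * of A + of B * of B - (of A * of B + of B * of A) ∈ relations ∧ ¬ Equivalent A B := by
  constructor
  · intro h
    obtain ⟨N, a, b, ha, hb, hsq, hne⟩ := not_reducedPeriodRing_iff_nonneg_pair.mp h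
    have hv : a.value = b.value := value_eq_of_amgm_mem_relations a b hsq
    have hpos : 0 < a.value := by
      have h0 : 0 ≤ a.value := setIntegral_nonneg (IntegralRep.measurableSet_domain_holds a) ha
      rcases h0.lt_or_eq with hlt | heq
      · exact hlt
      · exfalso
        apply hne
        have ha0 : of a ∈ relations := of_mem_relations_of_nonneg_of_value_eq_zero a ha heq.symm
        have hb0 : of b ∈ relations :=
          of_mem_relations_of_nonneg_of_value_eq_zero b hb (by rw [← hv]; exact heq.symm)
        exact relations.sub_mem ha0 hb0
    obtain ⟨m, A, hAc, hAi, hA1, haA⟩ := exists_compactVolume_of_value_pos a hpos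
    obtain ⟨m', B, hBc, hBi, hB1, hbB⟩ := exists_compactVolume_of_value_pos b (hv ▸ hpos)
    refine ⟨m, m', A, B, hAc, hAi, hA1, hBc, hBi, hB1, ?_, fun hAB => hne ?_⟩
    · have hd : (of A - of B) - (of a - of b) ∈ relations := by
        have heq : (of A - of B) - (of a - of b) = -(of a - of A) + (of b - of B) := by abel
        rw [heq]
        exact relations.add_mem (relations.neg_mem haA) hbB
      have h1 := mul_sub_mul_mem_relations hd hd
      have hsq' : (of a - of b) * (of a - of b) ∈ relations := by
        rw [sub_mul_sub_eq_amgm]; exact hsq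
      have h2 := relations.add_mem h1 hsq'
      rw [sub_add_cancel, sub_mul_sub_eq_amgm] at h2
      exact h2
    · have heq : of a - of b = (of a - of A) + (of A - of B) - (of b - of B) := by abel
      show of a - of b ∈ relations
      rw [heq]
      exact relations.sub_mem (relations.add_mem haA hAB) hbB
  · rintro ⟨m, m', A, B, -, -, -, -, -, -, hsq, hne⟩ h
    exact hne (h _ (by rw [sub_mul_sub_eq_amgm]; exact hsq))


/-- **A volume-pair witness must leave the plane, unless `PlanarAreas` fails**: under the shared
item `PlanarAreas` (stmt-KontsevichZagierPeriods-0117, routes LowDimension / HodgeLevel /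
SymplecticScissors: two planar integrand-`1` representations of equal area are KZ-equivalent —
written out as the hypothesis) no witness pair has both bodies planar, since the AM–GM chain forces
equal areas (`value_eq_of_amgm_mem_relations`). [folklore] -/
theorem no_planar_volume_witness
    (hPA : ∀ (r r' : IntegralRep 2), (∀ p ∈ r.domain, r.integrand p = 1) →
      (∀ p ∈ r'.domain, r'.integrand p = 1) → r.value = r'.value → Equivalent r r')
    (A B : IntegralRep 2) (hA1 : ∀ z ∈ A.domain, A.integrand z = 1)
    (hB1 : ∀ z ∈ B.domain, B.integrand z = 1)
    (hsq : of A * of A + of B * of B - (of A * of B + of B * of A) ∈ relations) :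
    Equivalent A B :=
  hPA A B hA1 hB1 (value_eq_of_amgm_mem_relations A B hsq)

end Summit.KontsevichZagierPeriods.KontsevichZagierPeriods.ReducedPeriodRingNegative
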